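import Summits.HodgeConjecture.CorCM.DecicWeil23MultiLeThreeHodgeOfMarkman
import HarnessLib

/-!
# COR-CM — FOUR pairwise distinct `(2,3)`-types over one decic CM field: the INDEPENDENCE CRITERION holds exactly off the
# four-cycles and the «triangle + disjoint edge» — the Hodge conjecture for every product of copies of `E, B₁, B₂, B₃, B₄` and
# every family with four type values, GIVEN ONLY Markman's hyperbolic-sixfold theorem (gen 23's «DECIC-23-QUAD»)

Cell `pub-hodgecm2` (COR-CM), seat b30 gen 24 (2026-08-22); count-neutral own lane DECIC-MULTI (the case `r = 4` of
`CorCM/DecicWeil23MultiHodgeOfMarkman`).  Theorems + one bookkeeping definition (`quadPos`, the positions of four types: a shape of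
`Census/DecicWeil23Triple` for the first three and a `2`-subset `{a₃, b₃}` for the fourth); no named fact of its own, no `sorry`.
HONEST FRAMING: the Hodge-conjecture statements are CONDITIONAL on the single displayed named fact
`HodgeTheory.Markman2025_weilClasses_algebraic_hyperbolicSixfold` (arXiv:2502.03415 Thm 1.5.1, unrefereed); `HC_CM` is not asserted.

THE GRAPH OF FOUR TYPES.  The `τ`-halves `Φ_m ∩ {s | s ∘ i = τ}` of four pairwise distinct `(2,3)`-types are four distinct edges of
the complete graph on the five embeddings over `τ`; up to isomorphism: the path `P₅`, the chair, the star `K_{1,4}`, the paw plus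
an isolated point, the four-cycle plus an isolated point, the triangle plus a disjoint edge.  By the exact census (gens 22–23) the
balanced weights of the products of copies are generated by pairs, Weil sixfold and tenfold weights EXACTLY in the first four cases
(`185` of the `210` configurations); the last two (`15 + 10`) carry the relations `Φ_ab − Φ_bc + Φ_cd − Φ_da ≡ 0` and
`Φ_ab + Φ_ac + Φ_bc + 2Φ_de ≡ const`.  Two intrinsic conditions single out the clean cases:
(H1) every type's `τ`-half MEETS another type's `τ`-half (kills the triangle + disjoint edge);
(H2) SOME embedding over `τ` lies in a number of the types different from `0` and `2` (kills the four-cycle).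

* §1 `quadPos`, and the kernel solve **`indepPos_quadPos`** (eight shapes × the `2`-subsets, `decide`/`omega` per case): under
  `a₃ ≠ b₃`, injectivity, (H1) and (H2) in the frame, the columns `𝟙, 𝟙_{I_0}, …, 𝟙_{I_3}` are independent.
* §2 **`hInd_four`** — four pairwise distinct `(2,3)`-types with (H1), (H2) satisfy the intrinsic independence criterion.
* §3 **`hodgeConjectureFor_of_avDominatedBy_family₄_of_markman_indep`** — any finite family of CM abelian fivefolds over `K` whose
  `(2,3)`-types are drawn from four pairwise distinct types with (H1), (H2), × `E^a`, everything dominated (`2`-transitive quintic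
  part, mod Markman's sixfold theorem); `hodgeConjectureFor_biproduct_comp_cons₄_of_markman_indep` for the products of copies of
  `E, B₁, …, B₄` themselves.
[cite: Markman2025SecantWeil, Thm 1.5.1] [cite: Shimura1998, §18.2 Lemma (i) and §6.1 Thm. 2 Cor.] [cite: MoonenZarhin1995Duke, Thm. 2.4]
[cite: MumfordAV1970, §19]

## References
* [Markman2025SecantWeil] E. Markman, arXiv:2502.03415 (unrefereed), Thm 1.5.1.  [Shimura1998] G. Shimura, *Abelian varieties
  with CM and modular functions*, §18.2 Lemma (i), §6.1 Thm. 2 Cor.  [MoonenZarhin1995Duke] B. Moonen, Yu. Zarhin, Duke Math. J.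
  77 (1995), Thm. 2.4.  [MumfordAV1970] D. Mumford, *Abelian Varieties*, §19.

## Provenance
Exact python first (gen 23, seat folder `work/`; gen 22 `HOME/pub-hodgecm2-b30/decic-23pair/multi_types.py`): `185` clean / `25` bad
configurations of four distinct `2`-subsets of five points under `A₅`, `S₅`, `F₂₀` alike.
-/

noncomputable section

open CategoryTheory CategoryTheory.Limits NumberField

namespace Summit.HodgeConjecture.CorCM.DecicWeil23Multi

open Literature.AlgebraicGeometry Literature.AlgebraicGeometry.Motives Literature.AlgebraicGeometry.HodgeTheory
open Literature.AlgebraicGeometry.ComplexMultiplication (IsCMTypeRealisation)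
open Literature.AlgebraicTopology.SingularHomology
open Summit.HodgeConjecture.CorCM.Census.DecicWeil23Multi (IndepPos)
open Summit.HodgeConjecture.CorCM.Census.DecicWeil23Triple (inPosT posT)
open Summit.HodgeConjecture.CorCM.DecicWeil23Pair (card_filter_symm_true₅ mem_iff_of_reading₅)
open Summit.HodgeConjecture.CorCM.DecicWeil23Triple (exists_frameT)
open Summit.HodgeConjecture.CorCM.Domination (AVDominatedBy)

open scoped Classical

/-! ## §1 The positions of four types and the kernel solve -/

/-- **The positions of four types**: the first three at a shape `c` of `Census/DecicWeil23Triple` (`posT c`), the fourth at the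
`2`-subset `{a₃, b₃}`. [folklore] -/
def quadPos (c : Fin 8) (a₃ b₃ : Fin 5) : Fin 4 → Fin 5 → Bool :=
  ![inPosT c 0, inPosT c 1, inPosT c 2, fun a => decide (a = a₃ ∨ a = b₃)]

section Solve

variable (a₃ b₃ : Fin 5)

/-- The solve for shape `0`: every `2`-subset `{a₃, b₃}` giving four distinct positions with (H1), (H2) yields independent
columns (`25` cases: contradiction by `decide` or `omega` on the five equations). [cite: MoonenZarhin1995Duke, Thm. 2.4] -/
private theorem solveQ0 (hab : a₃ ≠ b₃) (hinj : Function.Injective (quadPos 0 a₃ b₃))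
    (H1 : ∀ m : Fin 4, ∃ m', m' ≠ m ∧ ∃ x : Fin 5, quadPos 0 a₃ b₃ m x = true ∧ quadPos 0 a₃ b₃ m' x = true)
    (H2 : ∃ x : Fin 5, (Finset.univ.filter fun m => quadPos 0 a₃ b₃ m x = true).card ≠ 0 ∧
      (Finset.univ.filter fun m => quadPos 0 a₃ b₃ m x = true).card ≠ 2)
    (w t₀ t₁ t₂ t₃ : ℤ) (h : ∀ x : Fin 5, w + ((if quadPos 0 a₃ b₃ 0 x then t₀ else 0) + (if quadPos 0 a₃ b₃ 1 x then t₁ else 0) +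
      (if quadPos 0 a₃ b₃ 2 x then t₂ else 0) + (if quadPos 0 a₃ b₃ 3 x then t₃ else 0)) = 0) :
    w = 0 ∧ t₀ = 0 ∧ t₁ = 0 ∧ t₂ = 0 ∧ t₃ = 0 := by
  have h0 := h 0; have h1 := h 1; have h2 := h 2; have h3 := h 3; have h4 := h 4
  fin_cases a₃ <;> fin_cases b₃ <;>
    first
    | exact absurd rfl hab
    | exact absurd hinj (by decide)
    | exact absurd H1 (by decide)
    | exact absurd H2 (by decide)
    | (simp [quadPos, inPosT, posT] at h0 h1 h2 h3 h4; omega)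

/-- The solve for shape `1`: every `2`-subset `{a₃, b₃}` giving four distinct positions with (H1), (H2) yields independent
columns (`25` cases: contradiction by `decide` or `omega` on the five equations). [cite: MoonenZarhin1995Duke, Thm. 2.4] -/
private theorem solveQ1 (hab : a₃ ≠ b₃) (hinj : Function.Injective (quadPos 1 a₃ b₃))
    (H1 : ∀ m : Fin 4, ∃ m', m' ≠ m ∧ ∃ x : Fin 5, quadPos 1 a₃ b₃ m x = true ∧ quadPos 1 a₃ b₃ m' x = true)
    (H2 : ∃ x : Fin 5, (Finset.univ.filter fun m => quadPos 1 a₃ b₃ m x = true).card ≠ 0 ∧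
      (Finset.univ.filter fun m => quadPos 1 a₃ b₃ m x = true).card ≠ 2)
    (w t₀ t₁ t₂ t₃ : ℤ) (h : ∀ x : Fin 5, w + ((if quadPos 1 a₃ b₃ 0 x then t₀ else 0) + (if quadPos 1 a₃ b₃ 1 x then t₁ else 0) +
      (if quadPos 1 a₃ b₃ 2 x then t₂ else 0) + (if quadPos 1 a₃ b₃ 3 x then t₃ else 0)) = 0) :
    w = 0 ∧ t₀ = 0 ∧ t₁ = 0 ∧ t₂ = 0 ∧ t₃ = 0 := by
  have h0 := h 0; have h1 := h 1; have h2 := h 2; have h3 := h 3; have h4 := h 4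
  fin_cases a₃ <;> fin_cases b₃ <;>
    first
    | exact absurd rfl hab
    | exact absurd hinj (by decide)
    | exact absurd H1 (by decide)
    | exact absurd H2 (by decide)
    | (simp [quadPos, inPosT, posT] at h0 h1 h2 h3 h4; omega)

/-- The solve for shape `2`: every `2`-subset `{a₃, b₃}` giving four distinct positions with (H1), (H2) yields independent
columns (`25` cases: contradiction by `decide` or `omega` on the five equations). [cite: MoonenZarhin1995Duke, Thm. 2.4] -/
private theorem solveQ2 (hab : a₃ ≠ b₃) (hinj : Function.Injective (quadPos 2 a₃ b₃))
    (H1 : ∀ m : Fin 4, ∃ m', m' ≠ m ∧ ∃ x : Fin 5, quadPos 2 a₃ b₃ m x = true ∧ quadPos 2 a₃ b₃ m' x = true)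
    (H2 : ∃ x : Fin 5, (Finset.univ.filter fun m => quadPos 2 a₃ b₃ m x = true).card ≠ 0 ∧
      (Finset.univ.filter fun m => quadPos 2 a₃ b₃ m x = true).card ≠ 2)
    (w t₀ t₁ t₂ t₃ : ℤ) (h : ∀ x : Fin 5, w + ((if quadPos 2 a₃ b₃ 0 x then t₀ else 0) + (if quadPos 2 a₃ b₃ 1 x then t₁ else 0) +
      (if quadPos 2 a₃ b₃ 2 x then t₂ else 0) + (if quadPos 2 a₃ b₃ 3 x then t₃ else 0)) = 0) :
    w = 0 ∧ t₀ = 0 ∧ t₁ = 0 ∧ t₂ = 0 ∧ t₃ = 0 := by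
  have h0 := h 0; have h1 := h 1; have h2 := h 2; have h3 := h 3; have h4 := h 4
  fin_cases a₃ <;> fin_cases b₃ <;>
    first
    | exact absurd rfl hab
    | exact absurd hinj (by decide)
    | exact absurd H1 (by decide)
    | exact absurd H2 (by decide)
    | (simp [quadPos, inPosT, posT] at h0 h1 h2 h3 h4; omega)

/-- The solve for shape `3`: every `2`-subset `{a₃, b₃}` giving four distinct positions with (H1), (H2) yields independent
columns (`25` cases: contradiction by `decide` or `omega` on the five equations). [cite: MoonenZarhin1995Duke, Thm. 2.4] -/
private theorem solveQ3 (hab : a₃ ≠ b₃) (hinj : Function.Injective (quadPos 3 a₃ b₃))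
    (H1 : ∀ m : Fin 4, ∃ m', m' ≠ m ∧ ∃ x : Fin 5, quadPos 3 a₃ b₃ m x = true ∧ quadPos 3 a₃ b₃ m' x = true)
    (H2 : ∃ x : Fin 5, (Finset.univ.filter fun m => quadPos 3 a₃ b₃ m x = true).card ≠ 0 ∧
      (Finset.univ.filter fun m => quadPos 3 a₃ b₃ m x = true).card ≠ 2)
    (w t₀ t₁ t₂ t₃ : ℤ) (h : ∀ x : Fin 5, w + ((if quadPos 3 a₃ b₃ 0 x then t₀ else 0) + (if quadPos 3 a₃ b₃ 1 x then t₁ else 0) +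
      (if quadPos 3 a₃ b₃ 2 x then t₂ else 0) + (if quadPos 3 a₃ b₃ 3 x then t₃ else 0)) = 0) :
    w = 0 ∧ t₀ = 0 ∧ t₁ = 0 ∧ t₂ = 0 ∧ t₃ = 0 := by
  have h0 := h 0; have h1 := h 1; have h2 := h 2; have h3 := h 3; have h4 := h 4
  fin_cases a₃ <;> fin_cases b₃ <;>
    first
    | exact absurd rfl hab
    | exact absurd hinj (by decide)
    | exact absurd H1 (by decide)
    | exact absurd H2 (by decide)
    | (simp [quadPos, inPosT, posT] at h0 h1 h2 h3 h4; omega)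

/-- The solve for shape `4`: every `2`-subset `{a₃, b₃}` giving four distinct positions with (H1), (H2) yields independent
columns (`25` cases: contradiction by `decide` or `omega` on the five equations). [cite: MoonenZarhin1995Duke, Thm. 2.4] -/
private theorem solveQ4 (hab : a₃ ≠ b₃) (hinj : Function.Injective (quadPos 4 a₃ b₃))
    (H1 : ∀ m : Fin 4, ∃ m', m' ≠ m ∧ ∃ x : Fin 5, quadPos 4 a₃ b₃ m x = true ∧ quadPos 4 a₃ b₃ m' x = true)
    (H2 : ∃ x : Fin 5, (Finset.univ.filter fun m => quadPos 4 a₃ b₃ m x = true).card ≠ 0 ∧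
      (Finset.univ.filter fun m => quadPos 4 a₃ b₃ m x = true).card ≠ 2)
    (w t₀ t₁ t₂ t₃ : ℤ) (h : ∀ x : Fin 5, w + ((if quadPos 4 a₃ b₃ 0 x then t₀ else 0) + (if quadPos 4 a₃ b₃ 1 x then t₁ else 0) +
      (if quadPos 4 a₃ b₃ 2 x then t₂ else 0) + (if quadPos 4 a₃ b₃ 3 x then t₃ else 0)) = 0) :
    w = 0 ∧ t₀ = 0 ∧ t₁ = 0 ∧ t₂ = 0 ∧ t₃ = 0 := by
  have h0 := h 0; have h1 := h 1; have h2 := h 2; have h3 := h 3; have h4 := h 4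
  fin_cases a₃ <;> fin_cases b₃ <;>
    first
    | exact absurd rfl hab
    | exact absurd hinj (by decide)
    | exact absurd H1 (by decide)
    | exact absurd H2 (by decide)
    | (simp [quadPos, inPosT, posT] at h0 h1 h2 h3 h4; omega)

/-- The solve for shape `5`: every `2`-subset `{a₃, b₃}` giving four distinct positions with (H1), (H2) yields independent
columns (`25` cases: contradiction by `decide` or `omega` on the five equations). [cite: MoonenZarhin1995Duke, Thm. 2.4] -/
private theorem solveQ5 (hab : a₃ ≠ b₃) (hinj : Function.Injective (quadPos 5 a₃ b₃))
    (H1 : ∀ m : Fin 4, ∃ m', m' ≠ m ∧ ∃ x : Fin 5, quadPos 5 a₃ b₃ m x = true ∧ quadPos 5 a₃ b₃ m' x = true)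
    (H2 : ∃ x : Fin 5, (Finset.univ.filter fun m => quadPos 5 a₃ b₃ m x = true).card ≠ 0 ∧
      (Finset.univ.filter fun m => quadPos 5 a₃ b₃ m x = true).card ≠ 2)
    (w t₀ t₁ t₂ t₃ : ℤ) (h : ∀ x : Fin 5, w + ((if quadPos 5 a₃ b₃ 0 x then t₀ else 0) + (if quadPos 5 a₃ b₃ 1 x then t₁ else 0) +
      (if quadPos 5 a₃ b₃ 2 x then t₂ else 0) + (if quadPos 5 a₃ b₃ 3 x then t₃ else 0)) = 0) :
    w = 0 ∧ t₀ = 0 ∧ t₁ = 0 ∧ t₂ = 0 ∧ t₃ = 0 := by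
  have h0 := h 0; have h1 := h 1; have h2 := h 2; have h3 := h 3; have h4 := h 4
  fin_cases a₃ <;> fin_cases b₃ <;>
    first
    | exact absurd rfl hab
    | exact absurd hinj (by decide)
    | exact absurd H1 (by decide)
    | exact absurd H2 (by decide)
    | (simp [quadPos, inPosT, posT] at h0 h1 h2 h3 h4; omega)

/-- The solve for shape `6`: every `2`-subset `{a₃, b₃}` giving four distinct positions with (H1), (H2) yields independent
columns (`25` cases: contradiction by `decide` or `omega` on the five equations). [cite: MoonenZarhin1995Duke, Thm. 2.4] -/
private theorem solveQ6 (hab : a₃ ≠ b₃) (hinj : Function.Injective (quadPos 6 a₃ b₃))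
    (H1 : ∀ m : Fin 4, ∃ m', m' ≠ m ∧ ∃ x : Fin 5, quadPos 6 a₃ b₃ m x = true ∧ quadPos 6 a₃ b₃ m' x = true)
    (H2 : ∃ x : Fin 5, (Finset.univ.filter fun m => quadPos 6 a₃ b₃ m x = true).card ≠ 0 ∧
      (Finset.univ.filter fun m => quadPos 6 a₃ b₃ m x = true).card ≠ 2)
    (w t₀ t₁ t₂ t₃ : ℤ) (h : ∀ x : Fin 5, w + ((if quadPos 6 a₃ b₃ 0 x then t₀ else 0) + (if quadPos 6 a₃ b₃ 1 x then t₁ else 0) +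
      (if quadPos 6 a₃ b₃ 2 x then t₂ else 0) + (if quadPos 6 a₃ b₃ 3 x then t₃ else 0)) = 0) :
    w = 0 ∧ t₀ = 0 ∧ t₁ = 0 ∧ t₂ = 0 ∧ t₃ = 0 := by
  have h0 := h 0; have h1 := h 1; have h2 := h 2; have h3 := h 3; have h4 := h 4
  fin_cases a₃ <;> fin_cases b₃ <;>
    first
    | exact absurd rfl hab
    | exact absurd hinj (by decide)
    | exact absurd H1 (by decide)
    | exact absurd H2 (by decide)
    | (simp [quadPos, inPosT, posT] at h0 h1 h2 h3 h4; omega)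

/-- The solve for shape `7`: every `2`-subset `{a₃, b₃}` giving four distinct positions with (H1), (H2) yields independent
columns (`25` cases: contradiction by `decide` or `omega` on the five equations). [cite: MoonenZarhin1995Duke, Thm. 2.4] -/
private theorem solveQ7 (hab : a₃ ≠ b₃) (hinj : Function.Injective (quadPos 7 a₃ b₃))
    (H1 : ∀ m : Fin 4, ∃ m', m' ≠ m ∧ ∃ x : Fin 5, quadPos 7 a₃ b₃ m x = true ∧ quadPos 7 a₃ b₃ m' x = true)
    (H2 : ∃ x : Fin 5, (Finset.univ.filter fun m => quadPos 7 a₃ b₃ m x = true).card ≠ 0 ∧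
      (Finset.univ.filter fun m => quadPos 7 a₃ b₃ m x = true).card ≠ 2)
    (w t₀ t₁ t₂ t₃ : ℤ) (h : ∀ x : Fin 5, w + ((if quadPos 7 a₃ b₃ 0 x then t₀ else 0) + (if quadPos 7 a₃ b₃ 1 x then t₁ else 0) +
      (if quadPos 7 a₃ b₃ 2 x then t₂ else 0) + (if quadPos 7 a₃ b₃ 3 x then t₃ else 0)) = 0) :
    w = 0 ∧ t₀ = 0 ∧ t₁ = 0 ∧ t₂ = 0 ∧ t₃ = 0 := by
  have h0 := h 0; have h1 := h 1; have h2 := h 2; have h3 := h 3; have h4 := h 4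
  fin_cases a₃ <;> fin_cases b₃ <;>
    first
    | exact absurd rfl hab
    | exact absurd hinj (by decide)
    | exact absurd H1 (by decide)
    | exact absurd H2 (by decide)
    | (simp [quadPos, inPosT, posT] at h0 h1 h2 h3 h4; omega)

/-- **THE KERNEL SOLVE FOR FOUR TYPES.**  For every shape `c` and `2`-subset `{a₃, b₃}` such that the four positions `quadPos c a₃ b₃`
are pairwise distinct, (H1) every position set meets another and (H2) some point lies in a number of position sets `≠ 0, 2`, the
columns `𝟙, 𝟙_{I_0}, 𝟙_{I_1}, 𝟙_{I_2}, 𝟙_{I_3}` are linearly independent (`IndepPos`). [cite: MoonenZarhin1995Duke, Thm. 2.4] -/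
theorem indepPos_quadPos (c : Fin 8) (hab : a₃ ≠ b₃) (hinj : Function.Injective (quadPos c a₃ b₃))
    (H1 : ∀ m : Fin 4, ∃ m', m' ≠ m ∧ ∃ x : Fin 5, quadPos c a₃ b₃ m x = true ∧ quadPos c a₃ b₃ m' x = true)
    (H2 : ∃ x : Fin 5, (Finset.univ.filter fun m => quadPos c a₃ b₃ m x = true).card ≠ 0 ∧
      (Finset.univ.filter fun m => quadPos c a₃ b₃ m x = true).card ≠ 2) : IndepPos (quadPos c a₃ b₃) := by
  intro w t h
  have h' : ∀ x : Fin 5, w + ((if quadPos c a₃ b₃ 0 x then t 0 else 0) + (if quadPos c a₃ b₃ 1 x then t 1 else 0) +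
      (if quadPos c a₃ b₃ 2 x then t 2 else 0) + (if quadPos c a₃ b₃ 3 x then t 3 else 0)) = 0 := fun x => by
    rw [← Fin.sum_univ_four fun m => (if quadPos c a₃ b₃ m x then t m else 0)]
    exact h x
  have key : w = 0 ∧ t 0 = 0 ∧ t 1 = 0 ∧ t 2 = 0 ∧ t 3 = 0 := by
    fin_cases c
    exacts [solveQ0 a₃ b₃ hab hinj H1 H2 _ _ _ _ _ h', solveQ1 a₃ b₃ hab hinj H1 H2 _ _ _ _ _ h',
      solveQ2 a₃ b₃ hab hinj H1 H2 _ _ _ _ _ h', solveQ3 a₃ b₃ hab hinj H1 H2 _ _ _ _ _ h',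
      solveQ4 a₃ b₃ hab hinj H1 H2 _ _ _ _ _ h', solveQ5 a₃ b₃ hab hinj H1 H2 _ _ _ _ _ h',
      solveQ6 a₃ b₃ hab hinj H1 H2 _ _ _ _ _ h', solveQ7 a₃ b₃ hab hinj H1 H2 _ _ _ _ _ h']
  obtain ⟨hw, h₀, h₁, h₂, h₃⟩ := key
  refine ⟨hw, fun m => ?_⟩
  fin_cases m
  exacts [h₀, h₁, h₂, h₃]

end Solve

/-! ## §2 Four pairwise distinct types with (H1), (H2) satisfy the intrinsic independence criterion -/

section Intrinsic

variable {K : Type} [Field K] [NumberField K] {k : Type} [Field k] [NumberField k]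

/-- **FOUR PAIRWISE DISTINCT `(2,3)`-TYPES WITH (H1), (H2) SATISFY THE INDEPENDENCE CRITERION.**  `Φ : Fin 4 → CMType K` injective,
each of `k`-signature `(2,3)`; (H1) `hmeet`: for every `m` some `m' ≠ m` and some embedding over `τ` lie in both `Φ_m` and `Φ_{m'}`;
(H2) `hodd`: some embedding over `τ` lies in a number of the `Φ_m` different from `0` and `2`.  Then `w + Σ_{m : s ∈ Φ_m} t_m = 0` for
all `s` over `τ` forces `w = t = 0`.  (Frame: gen 22's `exists_frameT` for `Φ_0, Φ_1, Φ_2`, the fourth type read as a `2`-subset;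
then `indepPos_quadPos`.) [cite: Shimura1998, §18.2 Lemma (i)] [cite: MoonenZarhin1995Duke, Thm. 2.4] -/
theorem hInd_four (h10 : Module.finrank ℚ K = 10) (h2 : Module.finrank ℚ k = 2) (i : k →+* K) {τ : k →+* ℂ}
    (hττ : ComplexEmbedding.conjugate τ ≠ τ) (hk : ∀ σ : k →+* ℂ, σ = τ ∨ σ = ComplexEmbedding.conjugate τ)
    (Φ : Fin 4 → CMType K) (h23 : ∀ m, (Finset.univ.filter fun s : K →+* ℂ => s.comp i = τ ∧ s ∈ (Φ m).1).card = 2)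
    (hΦ : Function.Injective Φ)
    (hmeet : ∀ m : Fin 4, ∃ m', m' ≠ m ∧ ∃ s : K →+* ℂ, s.comp i = τ ∧ s ∈ (Φ m).1 ∧ s ∈ (Φ m').1)
    (hodd : ∃ s : K →+* ℂ, s.comp i = τ ∧ (Finset.univ.filter fun m => s ∈ (Φ m).1).card ≠ 0 ∧
      (Finset.univ.filter fun m => s ∈ (Φ m).1).card ≠ 2)
    (w : ℤ) (t : Fin 4 → ℤ) (h : ∀ s : K →+* ℂ, s.comp i = τ → w + ∑ m : Fin 4, (if s ∈ (Φ m).1 then t m else 0) = 0) :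
    w = 0 ∧ ∀ m, t m = 0 := by
  -- the frame for the first three types
  obtain ⟨e, c, he_sign, he_conj, hr₀, hr₁, hr₂⟩ := exists_frameT h10 h2 i hττ hk (Φ 0) (Φ 1) (Φ 2) (h23 0) (h23 1) (h23 2)
    (hΦ.ne (by decide)) (hΦ.ne (by decide)) (hΦ.ne (by decide))
  -- the fourth type as a `2`-subset `{a₃, b₃}`
  set J : Finset (Fin 5) := Finset.univ.filter fun a => e.symm (a, true) ∈ (Φ 3).1 with hJ
  have hJcard : J.card = 2 := by rw [hJ, card_filter_symm_true₅ he_sign (fun s => s ∈ (Φ 3).1)]; exact h23 3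
  obtain ⟨a₃, b₃, hab, hJeq⟩ := Finset.card_eq_two.1 hJcard
  have hr₃ : ∀ s, s ∈ (Φ 3).1 ↔ (e s).2 = decide ((e s).1 = a₃ ∨ (e s).1 = b₃) :=
    mem_iff_of_reading₅ (Φ := Φ 3) (P := fun a : Fin 5 => decide (a = a₃ ∨ a = b₃)) he_conj fun a => by
      have hmem : a ∈ J ↔ e.symm (a, true) ∈ (Φ 3).1 := by
        rw [hJ, Finset.mem_filter]
        exact ⟨fun h' => h'.2, fun h' => ⟨Finset.mem_univ _, h'⟩⟩
      rw [decide_eq_true_iff, ← hmem, hJeq, Finset.mem_insert, Finset.mem_singleton]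
  -- the four readings
  have hread : ∀ (m : Fin 4) (s : K →+* ℂ), s ∈ (Φ m).1 ↔ (e s).2 = quadPos c a₃ b₃ m (e s).1 := fun m =>
    Fin.cases hr₀ (fun m => Fin.cases hr₁ (fun m => Fin.cases hr₂ (fun m => Fin.cases hr₃ (fun l => l.elim0) m) m) m) m
  -- over `τ`, membership is the position
  have hmem : ∀ (m : Fin 4) (s : K →+* ℂ), s.comp i = τ → (s ∈ (Φ m).1 ↔ quadPos c a₃ b₃ m (e s).1 = true) := by
    intro m s hs
    rw [hread m s, (he_sign s).2 hs]
    exact ⟨fun h' => h'.symm, fun h' => h'.symm⟩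
  -- the frame hypotheses of the solve
  have hinj : Function.Injective (quadPos c a₃ b₃) := by
    intro m m' hmm'
    refine hΦ (Subtype.ext (Set.ext fun s => ?_))
    change s ∈ (Φ m).1 ↔ s ∈ (Φ m').1
    rw [hread m s, hread m' s, hmm']
  have H1 : ∀ m : Fin 4, ∃ m', m' ≠ m ∧ ∃ x : Fin 5, quadPos c a₃ b₃ m x = true ∧ quadPos c a₃ b₃ m' x = true := by
    intro m
    obtain ⟨m', hm', s, hs, hsm, hsm'⟩ := hmeet m
    exact ⟨m', hm', (e s).1, (hmem m s hs).1 hsm, (hmem m' s hs).1 hsm'⟩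
  have H2 : ∃ x : Fin 5, (Finset.univ.filter fun m => quadPos c a₃ b₃ m x = true).card ≠ 0 ∧
      (Finset.univ.filter fun m => quadPos c a₃ b₃ m x = true).card ≠ 2 := by
    obtain ⟨s, hs, h0, h2'⟩ := hodd
    refine ⟨(e s).1, ?_, ?_⟩ <;> rw [← Finset.filter_congr fun m _ => hmem m s hs]
    exacts [h0, h2']
  exact hInd_of_indepPos he_sign hread (indepPos_quadPos a₃ b₃ c hab hinj H1 H2) w t h

end Intrinsic

/-! ## §3 The Hodge conjecture for four types and for families with four type values -/

section Main

variable {K : Type} [Field K] [NumberField K] [IsCMField K] {k : Type} [Field k] [NumberField k] [IsCMField k] {N : ℕ}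
  {Φ : Fin 4 → CMType K} {B : Fin 4 → AbelianVariety ℂ}
  {ιB : ∀ m, 𝓞 K →+* End (B m)} {θB : ∀ m, K →+* Module.End ℂ (complexBetti (B m).X 1)}
  {n : ℕ} {Θ : Fin n → CMType K} {A : Fin n → AbelianVariety ℂ} {ι : ∀ j, 𝓞 K →+* End (A j)}
  {θ : ∀ j, K →+* Module.End ℂ (complexBetti (A j).X 1)}
  {Ψ : CMType k} {E : AbelianVariety ℂ} {ιE : 𝓞 k →+* End E} {θE : k →+* Module.End ℂ (complexBetti E.X 1)}

/-- **THE HODGE CONJECTURE FOR EVERY PRODUCT OF COPIES OF `E, B₁, B₂, B₃, B₄` — FOUR pairwise distinct `(2,3)`-types off the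
four-cycle and triangle-plus-edge configurations ((H1) `hmeet`, (H2) `hodd`), `2`-transitive quintic part, GIVEN ONLY Markman's
hyperbolic-sixfold theorem.**  The Hodge rings contain the six TENFOLD Weil classes of the `B_l × B̄_m`.
[cite: Markman2025SecantWeil, Thm 1.5.1] [cite: MoonenZarhin1995Duke, Thm. 2.4] -/
theorem hodgeConjectureFor_biproduct_comp_cons₄_of_markman_indep
    (hM6 : Markman2025_weilClasses_algebraic_hyperbolicSixfold)
    (h10 : Module.finrank ℚ K = 10) (h2 : Module.finrank ℚ k = 2) (i : k →+* K)
    (hB : ∀ m, IsCMTypeRealisation (Φ m) (B m) (ιB m) (θB m))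
    (hE : IsCMTypeRealisation Ψ E ιE θE) {τ : k →+* ℂ} (hτΨ : τ ∈ Ψ.1)
    (h23 : ∀ m, (Finset.univ.filter fun s : K →+* ℂ => s.comp i = τ ∧ s ∈ (Φ m).1).card = 2) (hΦ : Function.Injective Φ)
    (hmeet : ∀ m : Fin 4, ∃ m', m' ≠ m ∧ ∃ s : K →+* ℂ, s.comp i = τ ∧ s ∈ (Φ m).1 ∧ s ∈ (Φ m').1)
    (hodd : ∃ s : K →+* ℂ, s.comp i = τ ∧ (Finset.univ.filter fun m => s ∈ (Φ m).1).card ≠ 0 ∧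
      (Finset.univ.filter fun m => s ∈ (Φ m).1).card ≠ 2)
    (h2T : ∀ x y : Fin 2 ↪ {s : K →+* ℂ // s.comp i = τ}, ∃ ρ : ℂ ≃+* ℂ, ∀ j : Fin 2, (ρ : ℂ →+* ℂ).comp (x j).1 = (y j).1)
    (κ : Fin N → Fin 5) :
    HodgeConjectureFor (⨁ fun j => (Fin.cons E B : Fin 5 → AbelianVariety ℂ) (κ j)).dim
      (⨁ fun j => (Fin.cons E B : Fin 5 → AbelianVariety ℂ) (κ j)).X :=
  hodgeConjectureFor_biproduct_comp_cons_of_markman_indep hM6 h10 h2 i hB hE hτΨ h23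
    (hInd_four h10 h2 i (QuarticCM.conjugate_ne τ) (fun σ => QuarticCM.eq_or_eq_conjugate_of_quadratic h2 τ σ) Φ h23 hΦ
      hmeet hodd) h2T κ

/-- **THE FAMILY FORM WITH FOUR TYPE VALUES.**  `K ⊇ i(k)` decic with `Aut(ℂ)` `2`-transitive over `τ`; `Φ : Fin 4 → CMType K`
pairwise distinct `(2,3)`-types with (H1) `hmeet` and (H2) `hodd`; `A_j ⊨ (K; Θ_j)` (`j < n`) CM abelian fivefolds with every
`Θ_j` among the `Φ_m`; `E ⊨ (k; Ψ ∋ τ)`: every `C` dominated by `E^a × ∏_j A_j` satisfies the Hodge conjecture, GIVEN ONLY Markman's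
hyperbolic-sixfold theorem. [cite: Markman2025SecantWeil, Thm 1.5.1] [cite: Shimura1998, §6.1 Thm. 2 Cor.] [cite: MumfordAV1970, §19] -/
theorem hodgeConjectureFor_of_avDominatedBy_family₄_of_markman_indep
    (hM6 : Markman2025_weilClasses_algebraic_hyperbolicSixfold)
    (h10 : Module.finrank ℚ K = 10) (h2 : Module.finrank ℚ k = 2) (i : k →+* K)
    (hA : ∀ j, IsCMTypeRealisation (Θ j) (A j) (ι j) (θ j)) {τ : k →+* ℂ} (Φ : Fin 4 → CMType K)
    (h23 : ∀ m, (Finset.univ.filter fun s : K →+* ℂ => s.comp i = τ ∧ s ∈ (Φ m).1).card = 2) (hΦ : Function.Injective Φ)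
    (hmeet : ∀ m : Fin 4, ∃ m', m' ≠ m ∧ ∃ s : K →+* ℂ, s.comp i = τ ∧ s ∈ (Φ m).1 ∧ s ∈ (Φ m').1)
    (hodd : ∃ s : K →+* ℂ, s.comp i = τ ∧ (Finset.univ.filter fun m => s ∈ (Φ m).1).card ≠ 0 ∧
      (Finset.univ.filter fun m => s ∈ (Φ m).1).card ≠ 2)
    (hpos : ∀ j, ∃ m, Θ j = Φ m)
    (h2T : ∀ x y : Fin 2 ↪ {s : K →+* ℂ // s.comp i = τ}, ∃ ρ : ℂ ≃+* ℂ, ∀ l : Fin 2, (ρ : ℂ →+* ℂ).comp (x l).1 = (y l).1)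
    (hE : IsCMTypeRealisation Ψ E ιE θE) (hτΨ : τ ∈ Ψ.1) (a : ℕ)
    {C : AbelianVariety ℂ} (hC : AVDominatedBy C ((⨁ fun _ : Fin a => E).prod (⨁ A))) :
    HodgeConjectureFor C.dim C.X :=
  hodgeConjectureFor_of_avDominatedBy_family_of_markman_indep hM6 h10 h2 i hA Φ h23
    (hInd_four h10 h2 i (QuarticCM.conjugate_ne τ) (fun σ => QuarticCM.eq_or_eq_conjugate_of_quadratic h2 τ σ) Φ h23 hΦ
      hmeet hodd) hpos h2T hE hτΨ a hC

end Main

end Summit.HodgeConjecture.CorCM.DecicWeil23Multi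

end
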